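import Summits.QuantumFields.YangMills.Theses.EntropyBudgetEquipartition

/-!
# Birth skeleton (BC3) for the crux `FreeEnergyRate` of route `EntropyBudgetEquipartition` (item stmt-QuantumFields-22402)

FreeEnergyRate ⇐ stub_lowerRate (the pressure is AT LEAST its two-term asymptote minus `C β^(−κ)`: restriction to small fields + Gaussian
lower estimate in axial gauge — the constructive half) + stub_upperRate (the pressure is AT MOST the asymptote plus `C β^(−κ)`: large-field
domination — the hard half), both measured against Chatterjee's limit constant `chatterjeeK r = lim_β (f_r(β) + (3 dim G / 2) log β)`;
the composition `FreeEnergyRate_of` is kernel-checked (no sorry outside the two stubs).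
-/

namespace Summit.QuantumFields.YangMills.Cruxes.FreeEnergyRate.Birth

open Filter Topology
open Literature.MathematicalPhysics.QuantumFieldTheory Literature.MathematicalPhysics.QuantumLattice

/-- The dimension of the Lie algebra of `r(G)` (the route's `dim G`, typed as in the crux). -/
noncomputable def lieDim {G : Type} [Group G] [TopologicalSpace G] (r : LatticeRep G) : ℕ :=
  Module.finrank ℝ ↥(Submodule.span ℝ {X : Matrix (Fin r.N) (Fin r.N) ℂ |
    ∀ t : ℝ, NormedSpace.exp ((t : ℂ) • X) ∈ Set.range r.ρ})

/-- The reduced pressure `g_r(β) = f_r(β) + (3 dim G / 2) log β`. -/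
noncomputable def reducedPressure {G : Type} [Group G] [TopologicalSpace G] [IsTopologicalGroup G] [CompactSpace G]
    [MeasurableSpace G] [BorelSpace G] (r : LatticeRep G) (β : ℝ) : ℝ :=
  freeEnergyDensity 4 r.ρ β + (3 * (lieDim r : ℝ) / 2) * Real.log β

/-- Chatterjee's constant `K(G, r) = lim_{β → ∞} g_r(β)` (junk-valued `limUnder`; Chatterjee 2016 Thm 1.1 gives the limit). -/
noncomputable def chatterjeeK {G : Type} [Group G] [TopologicalSpace G] [IsTopologicalGroup G] [CompactSpace G]
    [MeasurableSpace G] [BorelSpace G] (r : LatticeRep G) : ℝ :=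
  limUnder atTop (reducedPressure r)

/-- stub 1 (LOWER RATE, size L — the constructive half): `g_r(β) ≥ K − C β^(−κ)` for `β ≥ β₀` (restrict the Haar integral to the
small-field region around the pure-gauge orbit, axial gauge on boxes, Gaussian evaluation from below with BCH error poly/√β, box
decoupling of the pressure at surface cost; Chatterjee arXiv:1602.01222 §3 lower bound, made quantitative). -/
theorem stub_lowerRate :
    ∀ (G : Type) [Group G] [TopologicalSpace G] [IsTopologicalGroup G] [CompactSpace G],
      IsCompactSimpleLieGroup G →
      letI : MeasurableSpace G := borel G
      haveI : BorelSpace G := ⟨rfl⟩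
      ∀ r : LatticeRep G, ∃ κ C β₀ : ℝ, 0 < κ ∧ ∀ β : ℝ, β₀ ≤ β →
        chatterjeeK r - C * β ^ (-κ) ≤ reducedPressure r β := by
  sorry

/-- stub 2 (UPPER RATE, size L/XL — the hard half): `g_r(β) ≤ K + C β^(−κ)` for `β ≥ β₀` (large-field domination: configurations
outside the small-field region do not raise the pressure above the Gaussian value by more than `C β^(−κ)` per site; Chatterjee §§4–6 upper
bound, made quantitative — this is where a power rate is genuinely new). -/
theorem stub_upperRate :
    ∀ (G : Type) [Group G] [TopologicalSpace G] [IsTopologicalGroup G] [CompactSpace G],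
      IsCompactSimpleLieGroup G →
      letI : MeasurableSpace G := borel G
      haveI : BorelSpace G := ⟨rfl⟩
      ∀ r : LatticeRep G, ∃ κ C β₀ : ℝ, 0 < κ ∧ ∀ β : ℝ, β₀ ≤ β →
        reducedPressure r β ≤ chatterjeeK r + C * β ^ (-κ) := by
  sorry

/-- COMPOSITION (kernel-checked, no sorry): the two one-sided rates give the crux with `K = chatterjeeK r`, `κ = min κ₁ κ₂`,
`C = |C₁| + |C₂|`, `β₀ = max (max β₁ β₂) 1`. -/
theorem FreeEnergyRate_of
    (h1 : ∀ (G : Type) [Group G] [TopologicalSpace G] [IsTopologicalGroup G] [CompactSpace G],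
      IsCompactSimpleLieGroup G →
      letI : MeasurableSpace G := borel G
      haveI : BorelSpace G := ⟨rfl⟩
      ∀ r : LatticeRep G, ∃ κ C β₀ : ℝ, 0 < κ ∧ ∀ β : ℝ, β₀ ≤ β →
        chatterjeeK r - C * β ^ (-κ) ≤ reducedPressure r β)
    (h2 : ∀ (G : Type) [Group G] [TopologicalSpace G] [IsTopologicalGroup G] [CompactSpace G],
      IsCompactSimpleLieGroup G →
      letI : MeasurableSpace G := borel G
      haveI : BorelSpace G := ⟨rfl⟩
      ∀ r : LatticeRep G, ∃ κ C β₀ : ℝ, 0 < κ ∧ ∀ β : ℝ, β₀ ≤ β →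
        reducedPressure r β ≤ chatterjeeK r + C * β ^ (-κ)) :
    Summit.QuantumFields.YangMills.Theses.EntropyBudgetEquipartition.FreeEnergyRate := by
  intro G _ _ _ _ hG
  letI : MeasurableSpace G := borel G
  haveI : BorelSpace G := ⟨rfl⟩
  intro r
  obtain ⟨κ₁, C₁, β₁, hκ₁, hlow⟩ := h1 G hG r
  obtain ⟨κ₂, C₂, β₂, hκ₂, hup⟩ := h2 G hG r
  refine ⟨chatterjeeK r, min κ₁ κ₂, |C₁| + |C₂|, max (max β₁ β₂) 1, lt_min hκ₁ hκ₂, ?_⟩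
  intro β hβ
  have hβ1 : (1 : ℝ) ≤ β := le_trans (le_max_right _ _) hβ
  have hβ₁ : β₁ ≤ β := le_trans (le_trans (le_max_left _ _) (le_max_left _ _)) hβ
  have hβ₂ : β₂ ≤ β := le_trans (le_trans (le_max_right _ _) (le_max_left _ _)) hβ
  have hl := hlow β hβ₁
  have hu := hup β hβ₂
  -- monotonicity of `β ↦ β^(-κ)` in `κ` for `β ≥ 1`
  have hm₁ : β ^ (-κ₁) ≤ β ^ (-(min κ₁ κ₂)) :=
    Real.rpow_le_rpow_of_exponent_le hβ1 (by simp)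
  have hm₂ : β ^ (-κ₂) ≤ β ^ (-(min κ₁ κ₂)) :=
    Real.rpow_le_rpow_of_exponent_le hβ1 (by simp)
  have hp₁ : 0 ≤ β ^ (-κ₁) := Real.rpow_nonneg (by linarith) _
  have hp₂ : 0 ≤ β ^ (-κ₂) := Real.rpow_nonneg (by linarith) _
  have hq : 0 ≤ β ^ (-(min κ₁ κ₂)) := Real.rpow_nonneg (by linarith) _
  have e1 : C₁ * β ^ (-κ₁) ≤ |C₁| * β ^ (-(min κ₁ κ₂)) :=
    le_trans (mul_le_mul_of_nonneg_right (le_abs_self C₁) hp₁) (mul_le_mul_of_nonneg_left hm₁ (abs_nonneg _))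
  have e2 : C₂ * β ^ (-κ₂) ≤ |C₂| * β ^ (-(min κ₁ κ₂)) :=
    le_trans (mul_le_mul_of_nonneg_right (le_abs_self C₂) hp₂) (mul_le_mul_of_nonneg_left hm₂ (abs_nonneg _))
  -- unfold the reduced pressure to the crux's literal expression
  have hg : reducedPressure r β = freeEnergyDensity 4 r.ρ β + (3 * (lieDim r : ℝ) / 2) * Real.log β := rfl
  rw [abs_le]
  constructor
  · show -( (|C₁| + |C₂|) * β ^ (-(min κ₁ κ₂))) ≤ _
    have : chatterjeeK r - C₁ * β ^ (-κ₁) ≤ freeEnergyDensity 4 r.ρ β + (3 * (lieDim r : ℝ) / 2) * Real.log β := hg ▸ hl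
    unfold lieDim at this
    nlinarith [this, e1, e2, abs_nonneg C₂, hq]
  · have : freeEnergyDensity 4 r.ρ β + (3 * (lieDim r : ℝ) / 2) * Real.log β ≤ chatterjeeK r + C₂ * β ^ (-κ₂) := hg ▸ hu
    unfold lieDim at this
    nlinarith [this, e1, e2, abs_nonneg C₁, hq]

end Summit.QuantumFields.YangMills.Cruxes.FreeEnergyRate.Birth
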